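import Summits.QuantumAdvantage.QuantumAdvantage.Theorems.AcZeroRung.Negative.LoadBearing

/-!
# `AcZeroRung` (stmt-QuantumAdvantage-2425) — III: the ladder inside the crux, and its set form

Sequel of `LoadBearing.lean` (same provenance: refuter work file
`Cruxes/AcZeroRung/Disproof.lean`, cycle 1). Sorry-free; the only mention of a Theses statement in
a conclusion is the negative `not_acZeroRung_of_not_digitRung` and the reformulation
`acZeroRung_iff_sets` (an `↔`, like `acZeroRung_iff`).

* §6 LADDER: `digit_and_block_of_acZeroRung` (input circuits: size 0, depth 0; constants) —
  the crux contains the signed single-digit sums and the block sum; `sum_filter_testBit_eq`;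
  `not_acZeroRung_of_not_digitRung` (`¬ DigitRung → ¬ AcZeroRung`: the crux contains the rank-2
  crux `DigitRung`, in particular its OPEN middle band `(5/43)n < j < (2/3)n`).
* §7 SET FORM: `acZeroRung_iff_sets : AcZeroRung ↔ SetRung famD` — the crux ⇔ "`∑_{d ∈ 𝒟_n, C(d)} (t(-d) - 2) = o(#𝒟_n)`
  uniformly over `acBasis` circuits of fixed depth and polynomial size", i.e. `#Cl₃` has mean `2`
  on every AC⁰-definable set of `n`-bit fundamental `-d` — the form in which counting theorems
  (Davenport–Heilbronn with congruence / interval / Bohr-set conditions) are consumed.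
-/

set_option linter.dupNamespace false

open scoped BigOperators Classical
open Filter Finset
open Literature.NumberTheory.QuadraticFields
open Literature.Computability.Complexity
open Literature.Probability.RandomGraphs.LowDegree (sgn sgn_true sgn_false)

noncomputable section

namespace Summit.QuantumAdvantage.QuantumAdvantage.Theorems.AcZeroRung.Negative

-- fullbuild repair 2026-08-17: `AcZeroRung` (stmt-QuantumAdvantage-2425, dropped from the route at rev 3) is now the
-- verbatim record `Negative.AcZeroRung` of `LoadBearing.lean` (this namespace); `DigitRung` is the route's live support
-- item stmt-QuantumAdvantage-15008.  No declaration below changed.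
open Summit.QuantumAdvantage.QuantumAdvantage.Theses.ArithStatLadder (DigitRung)

/-! ### The ladder inside the crux: constants and single digits -/

/-- **`AcZeroRung` contains the signed single-digit rung** (input circuits have size `0`, depth
`0`): for every pinned `t`, `ε > 0`, eventually `|∑_{𝒟_n} (t(-d) - 2)·sgn(bit_j d)| ≤ ε #𝒟_n`
for all `j < n`, and (constant circuit) `|∑_{𝒟_n} (t(-d) - 2)| ≤ ε #𝒟_n`. [folklore] -/
theorem digit_and_block_of_acZeroRung (h : AcZeroRung) {t : ℤ → ℕ} (ht : Pins t) {ε : ℝ} (hε : 0 < ε) :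
    ∀ᶠ n : ℕ in atTop, (∀ j : Fin n,
      |∑ d ∈ famD n, ((t (-(d:ℤ)) : ℝ) - 2) * sgn (Nat.testBit d j)| ≤ ε * ((famD n).card : ℝ)) ∧
      |∑ d ∈ famD n, ((t (-(d:ℤ)) : ℝ) - 2)| ≤ ε * ((famD n).card : ℝ) := by
  filter_upwards [acZeroRung_iff.mp h t ht 1 1 ε hε] with n hn
  refine ⟨fun j => ?_, ?_⟩
  · have := hn (Circuit.input j) (fun g hg => by simp [Circuit.input] at hg) (le_of_eq_of_le rfl zero_le_one)
      (by simp)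
    simpa [corrSum] using this
  · obtain ⟨C, hB, hd, hs, hev⟩ := exists_const_circuit n false
    have := hn C hB hd (by simpa using hs)
    rwa [corrSum_of_eval_const hev, sgn_false, one_mul] at this

/-- Half-sums from the full sum and the signed sum: `∑_{bit = b} f = (∑ f + σ_b ∑ f·sgn(bit)) / 2`
with `σ_false = 1`, `σ_true = -1`. [folklore] -/
theorem sum_filter_testBit_eq {n : ℕ} (f : ℕ → ℝ) (j : ℕ) (b : Bool) :
    ∑ d ∈ (famD n).filter (fun d : ℕ => Nat.testBit d j = b), f d =
      (∑ d ∈ famD n, f d + sgn b * ∑ d ∈ famD n, f d * sgn (Nat.testBit d j)) / 2 := by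
  rw [Finset.sum_filter, Finset.mul_sum, ← Finset.sum_add_distrib, Finset.sum_div]
  refine Finset.sum_congr rfl fun d _ => ?_
  cases b <;> cases Nat.testBit d j <;> simp [sgn]

/-- `AcZeroRung → DigitRung` (the rank-2 crux of the route, whose middle band is open): the
crux contains Davenport–Heilbronn on every digit half. Private: stated positively only as a step
towards the negative-lane form `not_acZeroRung_of_not_digitRung`. [folklore] -/
private theorem digitRung_of_acZeroRung (h : AcZeroRung) : DigitRung := by
  intro t ht ε hε
  filter_upwards [digit_and_block_of_acZeroRung h ht hε] with n hn
  intro j hj b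
  change |∑ d ∈ (famD n).filter (fun d : ℕ => Nat.testBit d j = b), ((t (-(d:ℤ)) : ℝ) - 2)| ≤
    ε * ((famD n).card : ℝ)
  rw [sum_filter_testBit_eq]
  have h1 := hn.1 ⟨j, hj⟩
  have h2 := hn.2
  rw [abs_div, abs_two, div_le_iff₀ two_pos]
  calc |∑ d ∈ famD n, ((t (-(d:ℤ)) : ℝ) - 2) + sgn b * ∑ d ∈ famD n, ((t (-(d:ℤ)) : ℝ) - 2) * sgn (Nat.testBit d j)|
      ≤ |∑ d ∈ famD n, ((t (-(d:ℤ)) : ℝ) - 2)| + |sgn b * ∑ d ∈ famD n, ((t (-(d:ℤ)) : ℝ) - 2) * sgn (Nat.testBit d j)| :=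
        abs_add_le _ _
    _ ≤ ε * ((famD n).card : ℝ) + ε * ((famD n).card : ℝ) := by
        refine add_le_add h2 ?_
        rw [abs_mul]
        cases b <;> simp only [sgn_true, sgn_false, abs_neg, abs_one, one_mul] <;> exact h1
    _ = ε * ((famD n).card : ℝ) * 2 := by ring

/-- **LADDER, negative lane: a refutation of `DigitRung` (rank-2 crux) refutes `AcZeroRung`.**
[folklore] -/
theorem not_acZeroRung_of_not_digitRung (h : ¬ DigitRung) : ¬ AcZeroRung :=
  fun hA => h (digitRung_of_acZeroRung hA)

/-! ### Reformulation over AC⁰-definable SETS (how counting theorems are consumed) -/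

/-- The crux in indicator form over a family `S n` of inputs: sums of `t(-d) - 2` over the
AC⁰-definable subsets `{d ∈ S n : C(d) = true}` (the crux's family is `famD`). [folklore] -/
def SetRung (S : ℕ → Finset ℕ) : Prop :=
  ∀ t : ℤ → ℕ, Pins t → ∀ k : ℕ, ∀ p : Polynomial ℕ, ∀ ε : ℝ, 0 < ε → ∀ᶠ n : ℕ in atTop,
    ∀ C : Circuit (Fin n), C.IsOver acBasis → C.acDepth ≤ k → C.size ≤ p.eval n →
      |∑ d ∈ (S n).filter (fun d : ℕ => C.eval (fun i : Fin n => Nat.testBit d i) = true),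
          ((t (-(d:ℤ)) : ℝ) - 2)| ≤ ε * ((S n).card : ℝ)

/-- Set sums from the full sum and the signed sum: `∑_{C = true} f = (∑ f - ∑ f·sgn C) / 2`. [folklore] -/
theorem sum_filter_eval_eq {n : ℕ} (f : ℕ → ℝ) (C : Circuit (Fin n)) :
    ∑ d ∈ (famD n).filter (fun d : ℕ => C.eval (fun i : Fin n => Nat.testBit d i) = true), f d =
      (∑ d ∈ famD n, f d - ∑ d ∈ famD n, f d * sgn (C.eval (fun i : Fin n => Nat.testBit d i))) / 2 := by
  rw [Finset.sum_filter, ← Finset.sum_sub_distrib, Finset.sum_div]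
  refine Finset.sum_congr rfl fun d _ => ?_
  cases C.eval (fun i : Fin n => Nat.testBit d i) <;> simp [sgn]

/-- **`AcZeroRung ↔ SetRung famD`**: the signed-correlation form and the set form are the same
statement (constants are circuits of depth 1, size 1; the parameters `k, p` absorb the shift). So a
prover may read the crux as "`#Cl₃` has mean `2` on every AC⁰-definable set of `n`-bit fundamental
`-d`, with error `o(#𝒟_n)` uniformly over circuits of fixed depth and polynomial size". [folklore] -/
theorem acZeroRung_iff_sets : AcZeroRung ↔ SetRung famD := by
  rw [acZeroRung_iff]
  constructor
  · intro h t ht k p ε hε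
    filter_upwards [h t ht (max k 1) (p + 1) ε hε] with n hn C hB hd hs
    obtain ⟨K, hKB, hKd, hKs, hKev⟩ := exists_const_circuit n false
    have h1 := hn C hB (hd.trans (le_max_left _ _)) (by simp; omega)
    have h2 := hn K hKB (hKd.trans (le_max_right _ _)) (by simp; omega)
    rw [corrSum_of_eval_const hKev, sgn_false, one_mul] at h2
    rw [sum_filter_eval_eq, abs_div, abs_two, div_le_iff₀ two_pos]
    calc |∑ d ∈ famD n, ((t (-(d:ℤ)) : ℝ) - 2) - corrSum t 2 n C|
        ≤ |∑ d ∈ famD n, ((t (-(d:ℤ)) : ℝ) - 2)| + |corrSum t 2 n C| := abs_sub _ _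
      _ ≤ ε * ((famD n).card : ℝ) + ε * ((famD n).card : ℝ) := add_le_add h2 h1
      _ = ε * ((famD n).card : ℝ) * 2 := by ring
  · intro h t ht k p ε hε
    have hε2 : 0 < ε / 3 := by positivity
    filter_upwards [h t ht (max k 1) (p + 1) (ε / 3) hε2] with n hn C hB hd hs
    obtain ⟨K, hKB, hKd, hKs, hKev⟩ := exists_const_circuit n true
    have h1 := hn C hB (hd.trans (le_max_left _ _)) (by simp; omega)
    have h2 := hn K hKB (hKd.trans (le_max_right _ _)) (by simp; omega)
    have hK : (famD n).filter (fun d : ℕ => K.eval (fun i : Fin n => Nat.testBit d i) = true) = famD n :=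
      Finset.filter_true_of_mem fun d _ => hKev _
    rw [hK] at h2
    have hC := sum_filter_eval_eq (fun d => ((t (-(d:ℤ)) : ℝ) - 2)) C
    rw [hC] at h1
    -- `corrSum = ∑ f - 2 ∑_{C = true} f`
    have hcorr : corrSum t 2 n C = ∑ d ∈ famD n, ((t (-(d:ℤ)) : ℝ) - 2) -
        2 * ((∑ d ∈ famD n, ((t (-(d:ℤ)) : ℝ) - 2) -
          ∑ d ∈ famD n, ((t (-(d:ℤ)) : ℝ) - 2) * sgn (C.eval (fun i : Fin n => Nat.testBit d i))) / 2) := by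
      rw [corrSum]; ring
    rw [hcorr]
    calc |∑ d ∈ famD n, ((t (-(d:ℤ)) : ℝ) - 2) - 2 * ((∑ d ∈ famD n, ((t (-(d:ℤ)) : ℝ) - 2) -
          ∑ d ∈ famD n, ((t (-(d:ℤ)) : ℝ) - 2) * sgn (C.eval (fun i : Fin n => Nat.testBit d i))) / 2)|
        ≤ |∑ d ∈ famD n, ((t (-(d:ℤ)) : ℝ) - 2)| + |2 * ((∑ d ∈ famD n, ((t (-(d:ℤ)) : ℝ) - 2) -
          ∑ d ∈ famD n, ((t (-(d:ℤ)) : ℝ) - 2) * sgn (C.eval (fun i : Fin n => Nat.testBit d i))) / 2)| :=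
          abs_sub _ _
      _ ≤ ε / 3 * ((famD n).card : ℝ) + 2 * (ε / 3 * ((famD n).card : ℝ)) := by
          refine add_le_add h2 ?_
          rw [abs_mul, abs_two]
          exact mul_le_mul_of_nonneg_left h1 zero_le_two
      _ = ε * ((famD n).card : ℝ) := by ring

end Summit.QuantumAdvantage.QuantumAdvantage.Theorems.AcZeroRung.Negative

end
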